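import Mathlib.Topology.Homotopy.Lifting
import Mathlib.Analysis.SpecialFunctions.Complex.Circle
import Mathlib.Topology.Order.IntermediateValue
import Mathlib.Analysis.Calculus.Deriv.Slope
import Literature.Topology.FourManifolds.KnotFraming
import Literature.Topology.FourManifolds.SmoothEmbeddingCriteria
import HarnessLib

/-!
# Lifting arcs on a knot to the parameter line (trunk T-4MAN)

Groundwork for orientation arguments along a smooth knot `K : 𝕊¹ → 𝕊³` (`Literature.Topology.FourManifolds.Knot`), used by
`BandSumCommProofs.lean` to prove that a band sum is traversed coherently along *both* arcs of the
band (`Literature.Topology.FourManifolds.BandData.orient_upper`) and hence the commutativity of the connected sum of knots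
(`Literature.Topology.FourManifolds.Knot.IsConnectedSum.comm_holds`). Everything here is proved; no named facts are introduced.

An *arc on `K`* is a continuous map `γ : ℝ → 𝕊³` with `γ '' [0, 1] ⊆ range K`; a *lift* of `γ`
is a continuous `φ : ℝ → ℝ` with `K (circlePt (φ s)) = γ s` on `[0, 1]`, where
`circlePt t = (cos 2πt, sin 2πt)` is the unit-period covering of `𝕊¹` (`TorusCoordinates.lean`)
and `K.curve = (↑) ∘ K ∘ circlePt : ℝ → ℝ⁴` the regular closed curve of `K` (`KnotFraming.lean`).

* `Literature.Topology.FourManifolds.Knot.exists_lift`: every arc on `K` lifts (`K` is a topological embedding, so `K⁻¹` is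
  continuous on `range K`; compose with `toCircle : 𝕊¹ → Circle` and lift through the covering
  `Circle.exp` by `IsCoveringMap.exists_path_lifts`).
* `Literature.Topology.FourManifolds.Knot.differentiableAt_lift`, `Literature.Topology.FourManifolds.Knot.deriv_coe_eq_deriv_lift_smul`: a lift of an arc
  which is smooth at an interior parameter is differentiable there, and the velocity of the arc
  is `φ'` times the velocity of `K.curve` (locally `φ = ang ∘ K⁻¹ ∘ γ` with the smooth left
  inverse of `Literature.Topology.FourManifolds.contMDiffOn_leftInverse_of_isImmersion` and a local section `ang` of
  `circlePt`, `Literature.Topology.FourManifolds.exists_local_section_circlePt`).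
* `Literature.Topology.FourManifolds.Knot.strictMonoOn_or_strictAntiOn_lift`: a lift of an embedded arc is strictly monotone.
* `Literature.Topology.FourManifolds.strictMonoOn_Icc_of_Ioo`, `Literature.Topology.FourManifolds.Knot.lift_one_le`,
  `Literature.Topology.FourManifolds.Knot.exists_sub_int_mem_Ioo_of_lift`, `Literature.Topology.FourManifolds.Knot.apply_circlePt_mem_image_of_lift`: the
  *window* `(φ 0, φ 1)` of an increasing lift: it is at most one period long, and a parameter
  `t` maps to the open arc iff `t` lies in the window modulo `ℤ`.
* `Literature.Topology.FourManifolds.Knot.deriv_coe_apply_circlePoint`, `Literature.Topology.FourManifolds.Knot.deriv_curve_add_int`: passage between the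
  `2π`-periodic parametrisation `θ ↦ K (cos θ, sin θ)` used by `BandSum.lean` and `K.curve`.

## Sources

Standard covering-space and one-variable arguments; all statements are tagged `[folklore]`
(path lifting for coverings: A. Hatcher, *Algebraic Topology* (2002), Prop. 1.30; continuous
injective real functions on intervals are strictly monotone: Mathlib
`ContinuousOn.strictMonoOn_of_injOn_Ioo`). Mathlib: `Circle.isCoveringMap_exp`,
`IsCoveringMap.exists_path_lifts`, `Topology.IsEmbedding.toHomeomorph`,
`MonotoneOn.derivWithin_nonneg`.
-/

open scoped Manifold ContDiff Topology Real
open Set Function Metric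

noncomputable section

namespace Literature.Topology.FourManifolds

/-- `toCircle : 𝕊¹ → Circle` is continuous. [folklore] -/
theorem continuous_toCircle : Continuous toCircle :=
  (contDiff_toC.continuous.comp continuous_subtype_val).subtype_mk _

namespace Knot

variable (K : Knot)

/-- `K (circlePt s) = K (circlePt t)` iff `s - t ∈ ℤ`. [folklore] -/
theorem apply_circlePt_eq_iff {s t : ℝ} : K (circlePt s) = K (circlePt t) ↔ ∃ m : ℤ, s = t + m := by
  rw [K.injective.eq_iff, circlePt_eq_circlePt_iff]

/-- **Lifting an arc on a knot.** A continuous `γ : ℝ → 𝕊³` whose values on `[0, 1]` lie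
on the knot `K` lifts on `[0, 1]` through the parametrisation `K ∘ circlePt : ℝ → 𝕊³` to a
continuous real function (path lifting for the universal covering of `K(𝕊¹) ≅ 𝕊¹`).
Hatcher (2002), Prop. 1.30. [folklore] -/
theorem exists_lift {γ : ℝ → (sphere (0 : EuclideanSpace ℝ (Fin 4)) 1)} (hγ : Continuous γ)
    (hmem : ∀ s ∈ Icc (0 : ℝ) 1, γ s ∈ range K) :
    ∃ φ : ℝ → ℝ, Continuous φ ∧ ∀ s ∈ Icc (0 : ℝ) 1, K (circlePt (φ s)) = γ s := by
  set h := K.isEmbedding.toHomeomorph with hh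
  set δ : C(unitInterval, Circle) :=
    ⟨fun s ↦ toCircle (h.symm ⟨γ s, hmem s s.2⟩),
      continuous_toCircle.comp (h.symm.continuous.comp
        ((hγ.comp continuous_subtype_val).subtype_mk _))⟩ with hδ
  obtain ⟨e, he⟩ := Circle.exp_surjective (δ 0)
  obtain ⟨Γ, hΓ, -⟩ := Circle.isCoveringMap_exp.exists_path_lifts δ e he.symm
  refine ⟨fun s ↦ Γ (projIcc 0 1 zero_le_one s) / (2 * π), ?_, ?_⟩
  · exact (Γ.continuous.comp continuous_projIcc).div_const _
  · intro s hs
    have h1 : toCircle (circlePt (Γ (projIcc 0 1 zero_le_one s) / (2 * π))) =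
        toCircle (h.symm ⟨γ s, hmem s hs⟩) := by
      rw [toCircle_circlePt, mul_div_cancel₀ _ (by positivity : (2 * π : ℝ) ≠ 0)]
      have := congrFun hΓ (projIcc 0 1 zero_le_one s)
      simp only [comp_apply] at this
      rw [this, hδ, ContinuousMap.coe_mk, projIcc_of_mem _ hs]
    rw [toCircle_injective h1]
    have h2 := congrArg Subtype.val (h.apply_symm_apply ⟨γ s, hmem s hs⟩)
    rwa [hh, Topology.IsEmbedding.toHomeomorph_apply_coe] at h2

/-- **Lifts are differentiable.** If `γ : ℝ → 𝕊³` is smooth at `s₀`, `φ` is continuous at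
`s₀` and `K (circlePt (φ s)) = γ s` near `s₀`, then `φ` is differentiable at `s₀`: locally
`φ = ang ∘ K⁻¹ ∘ γ` for a smooth left inverse `K⁻¹` of the embedding `K` on its range
(`Literature.Topology.FourManifolds.contMDiffOn_leftInverse_of_isImmersion`) and a local smooth section `ang` of `circlePt`
(`Literature.Topology.FourManifolds.exists_local_section_circlePt`). [folklore] -/
theorem differentiableAt_lift {γ : ℝ → (sphere (0 : EuclideanSpace ℝ (Fin 4)) 1)} {φ : ℝ → ℝ}
    {s₀ : ℝ}
    (hγ : ContMDiffAt 𝓘(ℝ, ℝ) (𝓡 3) ∞ γ s₀) (hφ : ContinuousAt φ s₀)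
    (heq : ∀ᶠ s in 𝓝 s₀, K (circlePt (φ s)) = γ s) : DifferentiableAt ℝ φ s₀ := by
  haveI : Nonempty ((sphere (0 : EuclideanSpace ℝ (Fin 2)) 1)) := ⟨circlePt 0⟩
  obtain ⟨g, hg⟩ := K.injective.hasLeftInverse
  have hgs : ContMDiffOn (𝓡 3) (𝓡 1) ∞ g (range K) :=
    contMDiffOn_leftInverse_of_isImmersion K.isSmoothEmbedding.isImmersion K.isEmbedding hg
  obtain ⟨ang, hang, hangeq⟩ := exists_local_section_circlePt (φ s₀)
  have hφeq : φ =ᶠ[𝓝 s₀] ang ∘ g ∘ γ := by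
    have h1 : ∀ᶠ s in 𝓝 s₀, ang (circlePt (φ s)) = φ s := hφ.eventually hangeq
    filter_upwards [h1, heq] with s hs1 hs2
    simp only [comp_apply, ← hs2, hg (circlePt (φ s)), hs1]
  have hmem : γ ⁻¹' range K ∈ 𝓝 s₀ := by
    filter_upwards [heq] with s hs
    exact ⟨_, hs⟩
  have h0 : γ s₀ ∈ range K := (mem_of_mem_nhds hmem : s₀ ∈ γ ⁻¹' range K)
  have hgγ : ContMDiffAt 𝓘(ℝ, ℝ) (𝓡 1) ∞ (g ∘ γ) s₀ :=
    ((hgs _ h0).comp s₀ hγ.contMDiffWithinAt (mapsTo_preimage γ (range K))).contMDiffAt hmem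
  have hval : (g ∘ γ) s₀ = circlePt (φ s₀) := by
    have := heq.self_of_nhds
    simp only [comp_apply, ← this, hg (circlePt (φ s₀))]
  have hcomp : ContMDiffAt 𝓘(ℝ, ℝ) 𝓘(ℝ, ℝ) ∞ (ang ∘ (g ∘ γ)) s₀ :=
    ContMDiffAt.comp s₀ (by rw [hval]; exact hang) hgγ
  have hd : DifferentiableAt ℝ (ang ∘ (g ∘ γ)) s₀ :=
    (contMDiffAt_iff_contDiffAt.mp hcomp).differentiableAt (by simp)
  exact hφeq.differentiableAt_iff.mpr hd

/-- **Velocity along a lifted arc.** Under the hypotheses of `differentiableAt_lift`, the velocity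
of the arc `γ` at `s₀` is `φ' (s₀)` times the velocity of the knot `K.curve = K ∘ circlePt` at the
parameter `φ s₀` (chain rule). [folklore] -/
theorem deriv_coe_eq_deriv_lift_smul {γ : ℝ → (sphere (0 : EuclideanSpace ℝ (Fin 4)) 1)} {φ : ℝ → ℝ}
    {s₀ : ℝ}
    (hγ : ContMDiffAt 𝓘(ℝ, ℝ) (𝓡 3) ∞ γ s₀) (hφ : ContinuousAt φ s₀)
    (heq : ∀ᶠ s in 𝓝 s₀, K (circlePt (φ s)) = γ s) :
    deriv (fun s ↦ (γ s : EuclideanSpace ℝ (Fin 4))) s₀ = deriv φ s₀ • deriv K.curve (φ s₀) := by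
  have hφd := K.differentiableAt_lift hγ hφ heq
  have h1 : (fun s ↦ (γ s : EuclideanSpace ℝ (Fin 4))) =ᶠ[𝓝 s₀] (K.curve ∘ φ) := by
    filter_upwards [heq] with s hs
    simp only [comp_apply, Knot.curve_apply, hs]
  rw [h1.deriv_eq]
  have hc : HasDerivAt K.curve (deriv K.curve (φ s₀)) (φ s₀) :=
    ((K.contDiff_curve.differentiable (by simp)) _).hasDerivAt
  exact (hc.scomp s₀ hφd.hasDerivAt).deriv

/-- A lift of an arc which is injective on `(a, b)` is strictly monotone or strictly antitone on
`(a, b)` (a continuous injective real function on an interval is strictly monotone). [folklore] -/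
theorem strictMonoOn_or_strictAntiOn_lift {γ : ℝ → (sphere (0 : EuclideanSpace ℝ (Fin 4)) 1)}
    {φ : ℝ → ℝ} {a b : ℝ} (hab : a < b)
    (hφ : ContinuousOn φ (Ioo a b)) (heq : ∀ s ∈ Ioo a b, K (circlePt (φ s)) = γ s)
    (hinj : InjOn γ (Ioo a b)) : StrictMonoOn φ (Ioo a b) ∨ StrictAntiOn φ (Ioo a b) := by
  refine hφ.strictMonoOn_of_injOn_Ioo hab fun s hs t ht hst ↦ hinj hs ht ?_
  rw [← heq s hs, ← heq t ht, hst]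

end Knot

/-! ### Windows of monotone lifts -/

/-- A real function continuous on `[0, 1]` and strictly increasing on `(0, 1)` is strictly
increasing on `[0, 1]`. [folklore] -/
theorem strictMonoOn_Icc_of_Ioo {φ : ℝ → ℝ} (hφ : ContinuousOn φ (Icc 0 1))
    (hmono : StrictMonoOn φ (Ioo 0 1)) : StrictMonoOn φ (Icc 0 1) := by
  have h0 : ∀ z ∈ Ioo (0 : ℝ) 1, φ 0 ≤ φ z := by
    intro z hz
    have ht : Filter.Tendsto φ (𝓝[Ioo 0 z] 0) (𝓝 (φ 0)) :=
      (hφ 0 ⟨le_rfl, zero_le_one⟩).tendsto.mono_left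
        (nhdsWithin_mono _ fun t ht ↦ ⟨ht.1.le, ht.2.le.trans hz.2.le⟩)
    haveI : (𝓝[Ioo (0 : ℝ) z] 0).NeBot := left_nhdsWithin_Ioo_neBot hz.1
    refine le_of_tendsto ht ?_
    filter_upwards [self_mem_nhdsWithin] with t ht'
    exact (hmono ⟨ht'.1, ht'.2.trans hz.2⟩ hz ht'.2).le
  have h1 : ∀ z ∈ Ioo (0 : ℝ) 1, φ z ≤ φ 1 := by
    intro z hz
    have ht : Filter.Tendsto φ (𝓝[Ioo z 1] 1) (𝓝 (φ 1)) :=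
      (hφ 1 ⟨zero_le_one, le_rfl⟩).tendsto.mono_left
        (nhdsWithin_mono _ fun t ht ↦ ⟨hz.1.le.trans ht.1.le, ht.2.le⟩)
    haveI : (𝓝[Ioo z (1 : ℝ)] 1).NeBot := right_nhdsWithin_Ioo_neBot hz.2
    refine ge_of_tendsto ht ?_
    filter_upwards [self_mem_nhdsWithin] with t ht'
    exact (hmono hz ⟨hz.1.trans ht'.1, ht'.2⟩ ht'.1).le
  intro x hx y hy hxy
  rcases hx.1.eq_or_lt with rfl | hx0
  · rcases hy.2.eq_or_lt with rfl | hy1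
    · calc φ 0 ≤ φ 4⁻¹ := h0 _ ⟨by norm_num, by norm_num⟩
        _ < φ 2⁻¹ := hmono ⟨by norm_num, by norm_num⟩ ⟨by norm_num, by norm_num⟩ (by norm_num)
        _ ≤ φ 1 := h1 _ ⟨by norm_num, by norm_num⟩
    · calc φ 0 ≤ φ (y / 2) := h0 _ ⟨by linarith, by linarith⟩
        _ < φ y := hmono ⟨by linarith, by linarith⟩ ⟨hxy, hy1⟩ (by linarith)
  · rcases hy.2.eq_or_lt with rfl | hy1
    · calc φ x < φ ((x + 1) / 2) :=
            hmono ⟨hx0, hxy⟩ ⟨by linarith, by linarith⟩ (by linarith)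
        _ ≤ φ 1 := h1 _ ⟨by linarith, by linarith⟩
    · exact hmono ⟨hx0, hxy.trans hy1⟩ ⟨hx0.trans hxy, hy1⟩ hxy

namespace Knot

variable (K : Knot)

/-- **The window of an increasing lift is at most one period long.** If `φ` is continuous on
`[0, 1]`, strictly increasing on `(0, 1)` and lifts an arc `γ` injective on `(0, 1)`, then
`φ 1 ≤ φ 0 + 1` (two parameters of `(φ 0, φ 1)` differing by the period `1` would give a double
point of `γ`). [folklore] -/
theorem lift_one_le {γ : ℝ → (sphere (0 : EuclideanSpace ℝ (Fin 4)) 1)} {φ : ℝ → ℝ}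
    (hφ : ContinuousOn φ (Icc 0 1))
    (hmono : StrictMonoOn φ (Ioo 0 1)) (heq : ∀ s ∈ Icc (0 : ℝ) 1, K (circlePt (φ s)) = γ s)
    (hinj : InjOn γ (Ioo 0 1)) : φ 1 ≤ φ 0 + 1 := by
  by_contra! hlt
  have himg := hφ.image_Ioo_of_strictMonoOn zero_le_one (strictMonoOn_Icc_of_Ioo hφ hmono)
  set y := (φ 0 + (φ 1 - 1)) / 2 with hy
  have hy0 : y ∈ Ioo (φ 0) (φ 1) := ⟨by rw [hy]; linarith, by rw [hy]; linarith⟩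
  have hy1 : y + 1 ∈ Ioo (φ 0) (φ 1) := ⟨by rw [hy]; linarith, by rw [hy]; linarith⟩
  rw [← himg] at hy0 hy1
  obtain ⟨s, hs, hsy⟩ := hy0
  obtain ⟨s', hs', hs'y⟩ := hy1
  have : γ s' = γ s := by
    rw [← heq s (Ioo_subset_Icc_self hs), ← heq s' (Ioo_subset_Icc_self hs'), hsy, hs'y,
      K.apply_circlePt_eq_iff]
    exact ⟨1, by simp⟩
  have hss' : s' = s := hinj hs' hs this
  have : φ s' = φ s + 1 := by rw [hs'y, hsy]
  rw [hss'] at this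
  linarith

/-- **Parameters over an arc lie in its window.** If `φ` (continuous on `[0, 1]`, strictly
increasing on `(0, 1)`) lifts `γ` on `[0, 1]`, then every parameter `t` with `K (circlePt t)`
on the open arc `γ '' (0, 1)` lies in the window `(φ 0, φ 1)` up to an integer. [folklore] -/
theorem exists_sub_int_mem_Ioo_of_lift {γ : ℝ → (sphere (0 : EuclideanSpace ℝ (Fin 4)) 1)}
    {φ : ℝ → ℝ} (hφ : ContinuousOn φ (Icc 0 1))
    (hmono : StrictMonoOn φ (Ioo 0 1)) (heq : ∀ s ∈ Icc (0 : ℝ) 1, K (circlePt (φ s)) = γ s)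
    {t : ℝ} (ht : K (circlePt t) ∈ γ '' Ioo 0 1) : ∃ m : ℤ, t - m ∈ Ioo (φ 0) (φ 1) := by
  obtain ⟨s, hs, hst⟩ := ht
  rw [← heq s (Ioo_subset_Icc_self hs), eq_comm, K.apply_circlePt_eq_iff] at hst
  obtain ⟨m, hm⟩ := hst
  refine ⟨m, ?_⟩
  rw [hm, add_sub_cancel_right,
    ← hφ.image_Ioo_of_strictMonoOn zero_le_one (strictMonoOn_Icc_of_Ioo hφ hmono)]
  exact mem_image_of_mem φ hs

/-- Conversely, every parameter in the window `(φ 0, φ 1)` of a lift maps to the open arc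
`γ '' (0, 1)`. [folklore] -/
theorem apply_circlePt_mem_image_of_lift {γ : ℝ → (sphere (0 : EuclideanSpace ℝ (Fin 4)) 1)}
    {φ : ℝ → ℝ}
    (hφ : ContinuousOn φ (Icc 0 1)) (hmono : StrictMonoOn φ (Ioo 0 1))
    (heq : ∀ s ∈ Icc (0 : ℝ) 1, K (circlePt (φ s)) = γ s) {t : ℝ} (ht : t ∈ Ioo (φ 0) (φ 1)) :
    K (circlePt t) ∈ γ '' Ioo 0 1 := by
  rw [← hφ.image_Ioo_of_strictMonoOn zero_le_one (strictMonoOn_Icc_of_Ioo hφ hmono)] at ht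
  obtain ⟨s, hs, rfl⟩ := ht
  exact ⟨s, hs, (heq s (Ioo_subset_Icc_self hs)).symm⟩

end Knot

/-! ### The `2π`-periodic parametrisation versus `Knot.curve` -/

namespace Knot

variable (K : Knot)

/-- `K (circlePoint θ) = K.curve (θ / 2π)` as maps into `ℝ⁴`. [folklore] -/
theorem coe_apply_circlePoint_eq :
    (fun θ ↦ (K (circlePoint θ) : EuclideanSpace ℝ (Fin 4))) = fun θ ↦ K.curve ((2 * π)⁻¹ * θ) := by
  funext θ
  rw [Knot.curve_apply, circlePt_eq_circlePoint, mul_inv_cancel_left₀ (by positivity)]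

/-- The velocity of the `2π`-periodic parametrisation `θ ↦ K (cos θ, sin θ)` is `(2π)⁻¹` times
the velocity of the unit-period parametrisation `K.curve` at `θ / 2π`. [folklore] -/
theorem deriv_coe_apply_circlePoint (θ : ℝ) :
    deriv (fun t ↦ (K (circlePoint t) : EuclideanSpace ℝ (Fin 4))) θ =
      (2 * π)⁻¹ • deriv K.curve ((2 * π)⁻¹ * θ) := by
  rw [coe_apply_circlePoint_eq, deriv_comp_mul_left]

/-- The velocity of `K.curve` has period `1` (integer shifts). [folklore] -/
theorem deriv_curve_add_int (t : ℝ) (m : ℤ) : deriv K.curve (t + m) = deriv K.curve t := by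
  have h : K.curve = fun s ↦ K.curve (s + m) := by
    funext s
    have := (K.periodic_curve.int_mul m) s
    rw [mul_one] at this
    exact this.symm
  conv_rhs => rw [h, deriv_comp_add_const]

end Knot

/-- A function strictly decreasing on `(0, 1)` has nonpositive derivative there. [folklore] -/
theorem deriv_nonpos_of_strictAntiOn_Ioo {φ : ℝ → ℝ} (h : StrictAntiOn φ (Ioo 0 1)) {s : ℝ}
    (hs : s ∈ Ioo (0 : ℝ) 1) : deriv φ s ≤ 0 := by
  rw [← derivWithin_of_mem_nhds (Ioo_mem_nhds hs.1 hs.2)]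
  exact h.antitoneOn.derivWithin_nonpos

/-- A function strictly increasing on `(0, 1)` has nonnegative derivative there. [folklore] -/
theorem deriv_nonneg_of_strictMonoOn_Ioo {φ : ℝ → ℝ} (h : StrictMonoOn φ (Ioo 0 1)) {s : ℝ}
    (hs : s ∈ Ioo (0 : ℝ) 1) : 0 ≤ deriv φ s := by
  rw [← derivWithin_of_mem_nhds (Ioo_mem_nhds hs.1 hs.2)]
  exact h.monotoneOn.derivWithin_nonneg

end Literature.Topology.FourManifolds
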